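import Literature.NumberTheory.EllipticCurves.IwasawaSelmerDualProofs
import Literature.NumberTheory.EllipticCurves.SelmerCorankControlRatProofs
import HarnessLib

set_option linter.dupNamespace false -- `…BirchSwinnertonDyer.BirchSwinnertonDyer…` is the cell's nested layout (D-0017)
set_option autoImplicit false

/-!
# Brick B6-U1 of the H46 kernel programme: UNIFORM killing exponents from Mazur control
# (`p^{c₀} · Sel_∞^{Γ_n} ⊆ res(Sel(E/K_n))`, `p^{k₀} · (ker res ∩ Sel(E/K_n)) = 0`)

Cell `bsd-2adic` (run/shared/lean/pub/bsd-2adic/), seat `bsd-2adic-tower-1` GEN 36; `--supports stmt-BirchSwinnertonDyer-19271` (helper,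
item `OrdKatoHalfAtTwo`, TOWER road; roadmap `HOME/tower/gen36/NOTE-B6-UNIVERSAL-NORMS-GEN36.md` §2 (iii), §5′ step 2). THEOREMS ONLY;
closes no item; nothing booked; BSD is not proved by any of this.

Mazur's control theorem in the tree's form (`W.selmer_control κ`: finite kernels and cokernels of
`s_n : Sel_{p^∞}(E/K_n) → Sel_{p^∞}(E/K_∞)^{Γ_n}`) gives, because all these groups are `p`-primary, UNIFORM exponents at each level:
* `exists_pow_nsmul_eq_zero_of_finite` — a finite family of `p`-power-torsion elements is killed by ONE power of `p`;
* `exists_pow_nsmul_mem_map_selmerLayer` — **`∃ c₀, p^{c₀} · (Sel_∞ ⊓ Sel_∞^{Γ_n}) ⊆ s_n(Sel(E/K_n))`** (cokernel);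
* `exists_pow_nsmul_eq_zero_of_mem_ker_layerToInfty` — **`∃ k₀, p^{k₀}` kills `ker s_n ∩ Sel(E/K_n)`** (kernel).
Over `ℚ` at every prime both hypotheses of `selmer_control` are tree theorems (`GoodOrdTower.selmer_control_all`).
[cite: GreenbergLNM1716, Thm 1.2 (pp. 59–60), §3 Lemmas 3.1–3.5] [cite: Mazur1972, §6]
-/

noncomputable section

open scoped Classical

namespace Summit.BirchSwinnertonDyer.BirchSwinnertonDyer.Theorems

namespace TorsionEulerChar.B6

open Literature.NumberTheory.EllipticCurves WeierstrassCurve NumberField IsDedekindDomain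

/-- **A finite family of `p`-power-torsion elements is killed by one power of `p`.** [folklore] -/
theorem exists_pow_nsmul_eq_zero_of_finite {A : Type*} [AddCommGroup A] (p : ℕ) {ι : Type*} [Finite ι] (x : ι → A)
    (hx : ∀ i, ∃ k : ℕ, p ^ k • x i = 0) : ∃ c : ℕ, ∀ i, p ^ c • x i = 0 := by
  choose k hk using hx
  haveI := Fintype.ofFinite ι
  refine ⟨Finset.univ.sup k, fun i ↦ ?_⟩
  obtain ⟨d, hd⟩ := Nat.exists_eq_add_of_le (Finset.le_sup (f := k) (Finset.mem_univ i))
  rw [hd, add_comm, pow_add, mul_nsmul', hk i, nsmul_zero]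

variable {K : Type} [Field K] [NumberField K] (W : WeierstrassCurve K) [W.IsElliptic] (p : ℕ) [hp : Fact p.Prime]
  (κ : ZpExtension K p)

/-- **Cokernel exponent of control.** Under `W.selmer_control κ` (with its hypotheses: `κ` cyclotomic, good ordinary reduction above `p`),
at every layer `n` there is `c₀` with `p^{c₀} · T ∈ s_n(Sel_{p^∞}(E/K_n))` for every `T ∈ Sel_∞ ∩ Sel_∞^{Γ_n}`: the cokernel is a finite
`p`-primary group. [cite: GreenbergLNM1716, Thm 1.2 (pp. 59–60)] -/
theorem exists_pow_nsmul_mem_map_selmerLayer (h : W.selmer_control κ) (hκ : κ.IsCyclotomic)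
    (hgo : ∀ v : HeightOneSpectrum (𝓞 K), (p : 𝓞 K) ∈ v.asIdeal → W.HasGoodReductionAt v ∧ W.HasUnitRootAt v) (n : ℕ) :
    ∃ c₀ : ℕ, ∀ T : W.subgroupH1 p κ.kerSubgroup, T ∈ W.selmerInfty κ ⊓ W.layerInvariants κ n →
      p ^ c₀ • T ∈ (W.selmerLayer κ n).map (W.layerToInfty κ n) := by
  obtain ⟨B, hB⟩ := h hκ hgo
  obtain ⟨-, -, hfin, -⟩ := hB n
  set S := W.selmerInfty κ ⊓ W.layerInvariants κ n
  set I := ((W.selmerLayer κ n).map (W.layerToInfty κ n)).addSubgroupOf S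
  haveI : Finite (S ⧸ I) := hfin
  -- every class of the quotient is `p`-power torsion
  have hprim : ∀ q : S ⧸ I, ∃ k : ℕ, p ^ k • q = 0 := by
    intro q
    induction q using QuotientAddGroup.induction_on with
    | H T =>
      obtain ⟨k, hk⟩ := W.exists_pow_smul_subgroupH1_ker_eq_zero (p := p) κ (T : W.subgroupH1 p κ.kerSubgroup)
      refine ⟨k, ?_⟩
      rw [← QuotientAddGroup.mk_nsmul, show p ^ k • T = 0 from Subtype.ext (by rw [AddSubgroupClass.coe_nsmul]; exact hk),
        QuotientAddGroup.mk_zero]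
  obtain ⟨c, hc⟩ := exists_pow_nsmul_eq_zero_of_finite p (fun q : S ⧸ I ↦ q) hprim
  refine ⟨c, fun T hT ↦ ?_⟩
  have h0 : (QuotientAddGroup.mk (p ^ c • (⟨T, hT⟩ : S)) : S ⧸ I) = 0 := by
    rw [QuotientAddGroup.mk_nsmul]; exact hc _
  rw [QuotientAddGroup.eq_zero_iff, AddSubgroup.mem_addSubgroupOf] at h0
  simpa only [AddSubgroupClass.coe_nsmul] using h0

/-- **Kernel exponent of control.** Under `W.selmer_control κ`, at every layer `n` there is `k₀` with `p^{k₀} · y = 0` for every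
`y ∈ ker s_n ∩ Sel_{p^∞}(E/K_n)`: the kernel is a finite `p`-primary group. [cite: GreenbergLNM1716, Thm 1.2, §3 Lemma 3.1] -/
theorem exists_pow_nsmul_eq_zero_of_mem_ker_layerToInfty (h : W.selmer_control κ) (hκ : κ.IsCyclotomic)
    (hgo : ∀ v : HeightOneSpectrum (𝓞 K), (p : 𝓞 K) ∈ v.asIdeal → W.HasGoodReductionAt v ∧ W.HasUnitRootAt v) (n : ℕ) :
    ∃ k₀ : ℕ, ∀ y : W.subgroupH1 p (κ.layerSubgroup n), y ∈ (W.layerToInfty κ n).ker ⊓ W.selmerLayer κ n → p ^ k₀ • y = 0 := by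
  obtain ⟨B, hB⟩ := h hκ hgo
  obtain ⟨hfin, -, -, -⟩ := hB n
  haveI : Finite ↥((W.layerToInfty κ n).ker ⊓ W.selmerLayer κ n) := hfin
  have hprim : ∀ y : ↥((W.layerToInfty κ n).ker ⊓ W.selmerLayer κ n), ∃ k : ℕ, p ^ k • y = 0 := fun y ↦ by
    obtain ⟨k, hk⟩ := W.exists_pow_smul_subgroupH1_layer_eq_zero (p := p) κ n (y : W.subgroupH1 p (κ.layerSubgroup n))
    exact ⟨k, Subtype.ext (by rw [AddSubgroupClass.coe_nsmul]; exact hk)⟩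
  obtain ⟨c, hc⟩ := exists_pow_nsmul_eq_zero_of_finite p (fun y : ↥((W.layerToInfty κ n).ker ⊓ W.selmerLayer κ n) ↦ y) hprim
  refine ⟨c, fun y hy ↦ ?_⟩
  have h0 := congrArg Subtype.val (hc ⟨y, hy⟩)
  simpa only [AddSubgroupClass.coe_nsmul, AddSubgroup.coe_zero] using h0

end TorsionEulerChar.B6

end Summit.BirchSwinnertonDyer.BirchSwinnertonDyer.Theorems
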